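import Summits.Ventures.PercRepro.S3MaxFlatKit

/-!
# PercRepro — THE MAXIMAL-FLAT SPLIT (p7 g22, S3 feeder): in a coloop-free matroid of rank `9`, either a rank-`6` set with
`n − 4` points exists (case B of the cells `(9, d)`), or every set of rank `≤ 6` has `≤ n − 5` points (case A)

A set of rank `a < 9` misses at least `9 − a + 1` points (coloop-freeness); so a set of rank `≤ 6` has `≤ n − 4` points, with
equality only at rank exactly `6` — `six_le_of_no_maxflat`.
Axioms: standard.
-/

open scoped Matroid

namespace PercRepro

namespace S3MF

open Set Finset

variable {α : Type} {M : Matroid α} [M.Finite]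

/-- **THE SPLIT**: if no rank-`6` set has `n − 4` points, every set of rank `≤ 6` has `≤ n − 5` points. -/
theorem six_le_of_no_maxflat {n : ℕ} (hM : M.eRank = ((9 : ℕ) : ℕ∞)) (hE : M.E.ncard = n) (hcol : M.coloops = ∅)
    (h : ¬ ∃ F ⊆ M.E, M.eRk F = ((6 : ℕ) : ℕ∞) ∧ F.ncard + 4 = M.E.ncard) :
    ∀ X ⊆ M.E, M.eRk X ≤ 6 → X.ncard ≤ n - 5 := by
  intro X hX hX6
  by_contra hlt
  push Not at hlt
  have hfin : M.eRk X ≠ ⊤ := ne_top_of_le_ne_top (ENat.coe_ne_top 6) hX6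
  obtain ⟨a, ha⟩ := ENat.ne_top_iff_exists.mp hfin
  have ha6 : a ≤ 6 := by
    rw [← ha] at hX6
    exact_mod_cast hX6
  have hmiss := S1.sub_add_one_le_ncard_ground_sdiff_of_coloops M hM hcol hX ha.symm (by omega)
  have hsum := ncard_sdiff_add_ncard_of_subset hX M.ground_finite
  have ha' : a = 6 := by omega
  apply h
  refine ⟨X, hX, ?_, by omega⟩
  rw [← ha, ha']

end S3MF

end PercRepro
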